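import Literature.AlgebraicGeometry.Motives.AbelianVarietyEquivariantHomCount
import Literature.AlgebraicGeometry.Motives.AbelianVarietyKernelComponentAction
import HarnessLib

/-!
# The `R`-simple pieces are unique up to equivariant isogeny (algebraically closed ground field)

Assembly of `Motives/AbelianVarietyEquivariantHomCount` (the equivariant Hom count and the
uniqueness of the multiplicities, granted Schur's lemma with operators `hSB`) and
`Motives/AbelianVarietyKernelComponentAction` (Schur's lemma with operators over an algebraically
closed field: a non-zero equivariant homomorphism between `R`-simple abelian varieties is an
isogeny, `isIsogeny_of_simpleFor_of_simpleFor`).  Over an ALGEBRAICALLY CLOSED field `K`, for a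
semiring `R` and abelian varieties with `R`-action:

* `AbelianVariety.card_equivariantlyIsogenous_eq_of_simpleFor` — **the multiplicities of the
  `R`-simple pieces are uniquely determined**: for equivariant decompositions up to isogeny
  `X ~ ⊕ Sᵢ`, `X' ~ ⊕ Tⱼ` into `R`-SIMPLE pieces of `R`-equivariantly isogenous `X → X'`, and any
  `R`-simple `(B, β)` of positive dimension, `#{i : Sᵢ ∼_R B} = #{j : Tⱼ ∼_R B}` (`∼_R`: an
  equivariant isogeny exists);
* `AbelianVariety.exists_equivariantlyIsogenous_piece_of_simpleFor` — **each `R`-simple piece of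
  positive dimension of the one decomposition is `R`-equivariantly isogenous to a piece of the
  other** — with the existence theorems (`Motives/AbelianVarietyEquivariantQuasiDecomposition*`:
  finite groups, orders of CM fields, `𝓞_K`) this is the Krull–Schmidt / Jordan–Hölder theorem of
  the isogeny category of abelian varieties WITH OPERATORS (Milne 1986 §12 p. 122 and Mumford §19
  Cor. 1 with operators; Lange–Rodríguez §2.9 for a finite group).

Everything is proved; no definition, no named fact (D-0026).

## References

* J. S. Milne, *Abelian Varieties*, in Cornell–Silverman (eds.), *Arithmetic Geometry* (1986), §12
  p. 122 («the `r_i` are uniquely determined and the `A_i` are uniquely determined up to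
  isogeny»; held copy `book:cornellnd-arithmetic-geometry`, PDF p. 189). [Milne1986AbelianVarieties]
* D. Mumford, *Abelian Varieties* (1970), §19 Thm. 1, Cor. 1–2 (pp. 173–174). [MumfordAV1970]
* H. Lange, R. E. Rodríguez, *Decomposition of Jacobians by Prym Varieties*, LNM 2310 (2022),
  §2.9. [LangeRodriguez2022]
-/

noncomputable section

universe u v

open CategoryTheory CategoryTheory.Limits AlgebraicGeometry

namespace Literature.AlgebraicGeometry.Motives

namespace AbelianVariety

variable {K : Type u} [Field K] [IsAlgClosed K] {R : Type v} [Semiring R]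
  {X : AbelianVariety K} {I : Type} [Fintype I] {S : I → AbelianVariety K}
  (ι : ∀ i, S i ⟶ X) (π : ∀ i, X ⟶ S i) {N : ℕ}

/-- **The multiplicities of the `R`-simple pieces are uniquely determined (algebraically closed
ground field).** For equivariant decompositions up to isogeny `X ~ ⊕ Sᵢ` of `(X, φ)` and
`X' ~ ⊕ Tⱼ` of `(X', φ')` into `R`-SIMPLE pieces `(Sᵢ, χᵢ)`, `(Tⱼ, τⱼ)`, an equivariant isogeny
`u : X ⟶ X'`, and an `R`-simple `(B, β)` of positive dimension, the number of `Sᵢ` admitting an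
equivariant isogeny to `B` equals the number of such `Tⱼ` — `card_equivariantlyIsogenous_eq_of_quasiDecompositions`
with Schur's lemma with operators (`isIsogeny_of_simpleFor_of_simpleFor`) supplying `hSB`, `hTB`.
[cite: Milne1986AbelianVarieties, §12 p. 122 (PDF p. 189)] [cite: LangeRodriguez2022, §2.9] -/
theorem card_equivariantlyIsogenous_eq_of_simpleFor (φ : R →+* End X)
    (χ : ∀ i, R →+* End (S i))
    (hS : ∀ i, ∀ (W : AbelianVariety K) (ω : R →+* End W) (w : W ⟶ S i),
      IsClosedImmersion (Hom.toSchemeHom w) →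
      (∀ r : R, w ≫ End.asHom (χ i r) = End.asHom (ω r) ≫ w) →
      0 < W.dim → W.dim < (S i).dim → False)
    (hN : 0 < N) (h1 : ∀ i, ι i ≫ π i = N • 𝟙 (S i)) (h2 : ∀ i j, i ≠ j → ι i ≫ π j = 0)
    (h3 : ∑ i, π i ≫ ι i = N • 𝟙 X)
    (hι : ∀ i (r : R), ι i ≫ End.asHom (φ r) = End.asHom (χ i r) ≫ ι i)
    (hπ : ∀ i (r : R), End.asHom (φ r) ≫ π i = π i ≫ End.asHom (χ i r))
    {X' : AbelianVariety K} (φ' : R →+* End X') {J : Type} [Fintype J]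
    {T : J → AbelianVariety K} (τ : ∀ j, R →+* End (T j))
    (hT : ∀ j, ∀ (W : AbelianVariety K) (ω : R →+* End W) (w : W ⟶ T j),
      IsClosedImmersion (Hom.toSchemeHom w) →
      (∀ r : R, w ≫ End.asHom (τ j r) = End.asHom (ω r) ≫ w) →
      0 < W.dim → W.dim < (T j).dim → False)
    (ι' : ∀ j, T j ⟶ X') (π' : ∀ j, X' ⟶ T j) {N' : ℕ} (hN' : 0 < N')
    (h1' : ∀ j, ι' j ≫ π' j = N' • 𝟙 (T j)) (h2' : ∀ j j', j ≠ j' → ι' j ≫ π' j' = 0)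
    (h3' : ∑ j, π' j ≫ ι' j = N' • 𝟙 X')
    (hι' : ∀ j (r : R), ι' j ≫ End.asHom (φ' r) = End.asHom (τ j r) ≫ ι' j)
    (hπ' : ∀ j (r : R), End.asHom (φ' r) ≫ π' j = π' j ≫ End.asHom (τ j r))
    {u : X ⟶ X'} (hu : IsIsogeny u) (hue : ∀ r : R, End.asHom (φ r) ≫ u = u ≫ End.asHom (φ' r))
    {B : AbelianVariety K} (β : R →+* End B) (hB : 0 < B.dim)
    (hBs : ∀ (W : AbelianVariety K) (ω : R →+* End W) (w : W ⟶ B),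
      IsClosedImmersion (Hom.toSchemeHom w) →
      (∀ r : R, w ≫ End.asHom (β r) = End.asHom (ω r) ≫ w) → 0 < W.dim → W.dim < B.dim → False) :
    Nat.card {i // ∃ v : S i ⟶ B, IsIsogeny v ∧
        ∀ r : R, End.asHom (χ i r) ≫ v = v ≫ End.asHom (β r)} =
      Nat.card {j // ∃ v : T j ⟶ B, IsIsogeny v ∧
        ∀ r : R, End.asHom (τ j r) ≫ v = v ≫ End.asHom (β r)} :=
  card_equivariantlyIsogenous_eq_of_quasiDecompositions ι π φ χ hN h1 h2 h3 hι hπ φ' τ ι' π' hN'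
    h1' h2' h3' hι' hπ' hu hue β hB
    (fun i f hf hf0 ↦ isIsogeny_of_simpleFor_of_simpleFor f (χ i) β hf (hS i) hBs hf0)
    (fun j f hf hf0 ↦ isIsogeny_of_simpleFor_of_simpleFor f (τ j) β hf (hT j) hBs hf0)

/-- **Each `R`-simple piece is determined up to equivariant isogeny (algebraically closed ground
field)**: in the situation of `card_equivariantlyIsogenous_eq_of_simpleFor`, every piece `S_{i₀}`
of positive dimension admits an equivariant isogeny `T_j ⟶ S_{i₀}` from some piece of the other
decomposition — the `R`-simple pieces of an abelian variety with `R`-action are unique up to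
`R`-equivariant isogeny (Krull–Schmidt for the isogeny category with operators).
[cite: Milne1986AbelianVarieties, §12 p. 122 (PDF p. 189)] [cite: MumfordAV1970, §19 Cor. 1 of Thm. 1 (p. 173)]
[cite: LangeRodriguez2022, §2.9] -/
theorem exists_equivariantlyIsogenous_piece_of_simpleFor (φ : R →+* End X)
    (χ : ∀ i, R →+* End (S i))
    (hS : ∀ i, ∀ (W : AbelianVariety K) (ω : R →+* End W) (w : W ⟶ S i),
      IsClosedImmersion (Hom.toSchemeHom w) →
      (∀ r : R, w ≫ End.asHom (χ i r) = End.asHom (ω r) ≫ w) →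
      0 < W.dim → W.dim < (S i).dim → False)
    (hN : 0 < N) (h1 : ∀ i, ι i ≫ π i = N • 𝟙 (S i)) (h2 : ∀ i j, i ≠ j → ι i ≫ π j = 0)
    (h3 : ∑ i, π i ≫ ι i = N • 𝟙 X)
    (hι : ∀ i (r : R), ι i ≫ End.asHom (φ r) = End.asHom (χ i r) ≫ ι i)
    (hπ : ∀ i (r : R), End.asHom (φ r) ≫ π i = π i ≫ End.asHom (χ i r))
    {X' : AbelianVariety K} (φ' : R →+* End X') {J : Type} [Fintype J]
    {T : J → AbelianVariety K} (τ : ∀ j, R →+* End (T j))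
    (hT : ∀ j, ∀ (W : AbelianVariety K) (ω : R →+* End W) (w : W ⟶ T j),
      IsClosedImmersion (Hom.toSchemeHom w) →
      (∀ r : R, w ≫ End.asHom (τ j r) = End.asHom (ω r) ≫ w) →
      0 < W.dim → W.dim < (T j).dim → False)
    (ι' : ∀ j, T j ⟶ X') (π' : ∀ j, X' ⟶ T j) {N' : ℕ} (hN' : 0 < N')
    (h1' : ∀ j, ι' j ≫ π' j = N' • 𝟙 (T j)) (h2' : ∀ j j', j ≠ j' → ι' j ≫ π' j' = 0)
    (h3' : ∑ j, π' j ≫ ι' j = N' • 𝟙 X')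
    (hι' : ∀ j (r : R), ι' j ≫ End.asHom (φ' r) = End.asHom (τ j r) ≫ ι' j)
    (hπ' : ∀ j (r : R), End.asHom (φ' r) ≫ π' j = π' j ≫ End.asHom (τ j r))
    {u : X ⟶ X'} (hu : IsIsogeny u) (hue : ∀ r : R, End.asHom (φ r) ≫ u = u ≫ End.asHom (φ' r))
    (i₀ : I) (hi₀ : 0 < (S i₀).dim) :
    ∃ (j : J) (v : T j ⟶ S i₀), IsIsogeny v ∧
      ∀ r : R, End.asHom (τ j r) ≫ v = v ≫ End.asHom (χ i₀ r) :=
  exists_equivariantlyIsogenous_piece_of_quasiDecompositions ι π φ χ hN h1 h2 h3 hι hπ φ' τ ι' π'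
    hN' h1' h2' h3' hι' hπ' hu hue i₀ hi₀
    (fun i f hf hf0 ↦ isIsogeny_of_simpleFor_of_simpleFor f (χ i) (χ i₀) hf (hS i) (hS i₀) hf0)
    (fun j f hf hf0 ↦ isIsogeny_of_simpleFor_of_simpleFor f (τ j) (χ i₀) hf (hT j) (hS i₀) hf0)

end AbelianVariety

end Literature.AlgebraicGeometry.Motives

end
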